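import Summits.BirchSwinnertonDyer.BirchSwinnertonDyer.Theorems.SignedLowerHalvesSprungLowerDivisibilityAtThreeKatoSporadicLedger
import Literature.NumberTheory.EllipticCurves.Kato2004.EulerSystemBoundFineSelmerContragredient
import Literature.NumberTheory.EllipticCurves.Kato2004.EulerSystemHypothesisVProofs
import Literature.NumberTheory.EllipticCurves.Kato2004.IwasawaInvolutionTwistProofs
import Literature.NumberTheory.EllipticCurves.SerreAdicOpenImageCongruence
import Literature.NumberTheory.EllipticCurves.IwasawaAlgebraInvolution
import Literature.NumberTheory.EllipticCurves.IwasawaAlgebraDivisibilityProofs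
import Literature.NumberTheory.EllipticCurves.IwasawaAlgebraHeightOneCriterionProofs
import HarnessLib

/-!
# Crux K1 `SprungLowerDivisibilityAtThree` (stmt-BirchSwinnertonDyer-19875), line `chromatic-common-zeros` (skeleton v8),
# stub K_spor `stub_katoFineLowerSporadic`: KATO'S THEOREM IN THE SPORADIC LEDGER, PRINT-KEYED
# (`--supports` 19875 as helper; closes nothing; K_spor / K1 / leaf X8 / BSD are NOT proved here)

Cell `bsd-ssimc`, width seat `cruxlead-…-19875-w2` (g7); third file of the ledger (`…KatoSporadicLedger`,
`…KatoSporadicLedgerX8`). STUB-PLAN-stub_katoFineLowerSporadic §3 β2 / k3 A1 («Kato's upper bound off `p` for the PACKAGE …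
DVR generator choice») and §0bis (the KEYING caveat), as kernel theorems. Notation at a height-one `𝔭` of `Λ = ℤ_p⟦T⟧` for a
♯/♭ Coleman–Kato package `C` of colour `•` (`L^• ≠ 0`, `E[p]` irreducible, Néron-normalised `G₁ ≠ 0`) on a pinned `I`:
`k(𝔭) = ℓ_𝔭(I.H ⧸ C.Z)`, `m^• = ℓ_𝔭 Λ/(G₁)`, `c^• = ℓ_𝔭(Λ ⧸ range Col^•)`; `ι𝔭 := PrimeSpectrum.comap (invol p) 𝔭`.

* §1 A DVR-GENERATOR CHOICE THROUGH `Col^•` (no cyclicity hypothesis on `I.H`): if `z₀` lies in the `Λ`-span of a set `S ⊆ I.H`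
  and `Col(z₀) ≠ 0`, some `s ∈ S` has `Col(s) ≠ 0` and `ℓ_𝔭 Λ/(Col s) ≤ ℓ_𝔭 Λ/(Col z₀)`
  (`exists_mem_lengthAt_quotient_span_le_of_mem_span`; the set `{z | π^{e+1} ∣ Col z}` is a submodule). Applied to Kato's
  `Z ≤ span{Euler-system classes}` (`zeta_le_span`) and `s₁G₁ ∈ Col(Z)` (`image_zeta_localized`): an Euler-system class `s ≠ 0`
  with `ℓ_𝔭(I.H ⧸ Λs) ≤ k(𝔭)` (`SharpFlatColemanKatoData.exists_isEulerSystemClass_lengthAt_quotient_le_zeta`).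
* §2 KATO'S THM. 12.5/13.4 (2) IN THE LEDGER, PRINT-KEYED: for a fine dual datum `FB` of key `γ⁻¹` (Kato's NATURAL `X₀` against
  the natural `I`, the print-exact transcription `thm13_4_lengthAt_fineSelmerDualContra_le_of_isEulerSystemClass`) and `E`
  non-CM (hypothesis (v) from Serre's open image): `ℓ_𝔭 FB.X ≤ k(𝔭)` at every height-one `𝔭 ∌ p`
  (`SharpFlatColemanKatoData.fineContra_le_zeta_of_thm13_4`). CONDITIONAL on the displayed named facts `h134C`, `hSerre`.
* §3 THE KEYING, CONCRETELY: for the stub's γ-keyed `Y`, `ℓ_{ι𝔭} Y.X = ℓ_𝔭 FB.X ≤ k(𝔭)` (`…fine_comap_invol_le_zeta_of_thm13_4`);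
  hence the typed body of `stub_katoFineLowerSporadic` at `ι𝔭` (`k(ι𝔭) ≤ ℓ_{ι𝔭} Y.X`) forces `k(ι𝔭) ≤ k(𝔭)`, and the typed
  body on the ι-ORBIT `{𝔭, ι𝔭}` forces INDEX SYMMETRY `k(𝔭) = k(ι𝔭)` (`…zeta_comap_invol_eq_zeta_of_katoFineLowerAt_pair`) —
  STUB-PLAN §0bis / card k2 §0 («typed K_spor on a sporadic ι-pair ⟺ Kato MC ∧ index symmetry») with the tree's real objects.
  Together with `…KatoSporadicLedger` (`x ≤ k` γ-keyed from Thm. 7.16's output; the defect `j`): BOTH keyings of Kato's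
  direction are now kernel theorems for the ♯/♭ package.

HONEST FRAMING: Kato's ⊇ half only; the Eisenstein half (K_spor) is untouched. CONDITIONAL on `h134C` (Kato 2004 Thm. 13.4,
print-exact key), `hSerre` (Serre's open image, congruence form); `¬ CM` displayed (automatic on X8: `ClassX8.not_hasCM`).

References: [Kato2004Asterisque] Thm. 12.4–12.6 (pp. 221–222), Thm. 13.4 (p. 226), Ex. 13.3 (p. 225), §17.13 (p. 280);
[Sprung2012] Def. 6.1, Thm. 7.14 (3) (p. 1504); [SerreAbelianLadic1968] IV-11; [Greenberg1989] §0 (the involution);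
tree: `Kato2004/EulerSystemBoundFineSelmerContragredient.lean` ("The point"), `Kato2004/IwasawaInvolutionTwistProofs.lean`.
-/

set_option linter.dupNamespace false
set_option autoImplicit false

noncomputable section

open scoped Classical NumberField MatrixGroups ModularForm

open NumberField IsDedekindDomain CongruenceSubgroup WeierstrassCurve Field
  Literature.NumberTheory.EllipticCurves Literature.NumberTheory.EllipticCurves.ModularForms
  Literature.NumberTheory.EllipticCurves.ZpExtension Literature.NumberTheory.EllipticCurves.Sprung2017
  Literature.NumberTheory.EllipticCurves.Sprung2012 Literature.NumberTheory.EllipticCurves.Kato2004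
  Literature.NumberTheory.EllipticCurves.IwasawaAlgebra Literature.NumberTheory.EllipticCurves.Module
  Summit.BirchSwinnertonDyer.BirchSwinnertonDyer.Theorems
  Summit.BirchSwinnertonDyer.BirchSwinnertonDyer.Theorems.SmallImageSignedMuDefect

namespace Summit.BirchSwinnertonDyer.BirchSwinnertonDyer.Theorems.ChromaticCommonZeros

/-! ### §1 A DVR-generator choice through an embedding `H ↪ Λ` -/

section Generator

variable {p : ℕ} [Fact p.Prime] {H : Type*} [AddCommGroup H] [Module (IwasawaAlgebra p) H]

/-- **Generator choice at a height-one prime, through a linear map `c : H → Λ`.** If `z₀` lies in the `Λ`-span of `S ⊆ H` and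
`c z₀ ≠ 0`, then some `s ∈ S` has `c s ≠ 0` and `ℓ_𝔭 Λ/(c s) ≤ ℓ_𝔭 Λ/(c z₀)`: otherwise every `c s` is divisible by
`π^{e+1}` (`𝔭 = (π)`, `e = ord_π(c z₀)`), a condition defining a submodule containing `S`, hence `z₀`. [folklore] -/
theorem exists_mem_lengthAt_quotient_span_le_of_mem_span (c : H →ₗ[IwasawaAlgebra p] IwasawaAlgebra p)
    {S : Set H} {z₀ : H} (hz₀ : z₀ ∈ Submodule.span (IwasawaAlgebra p) S) (hc₀ : c z₀ ≠ 0)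
    (𝔭 : PrimeSpectrum (IwasawaAlgebra p)) (h𝔭 : 𝔭.asIdeal.height = 1) :
    ∃ s ∈ S, c s ≠ 0 ∧
      lengthAt (IwasawaAlgebra p) (IwasawaAlgebra p ⧸ Ideal.span {c s}) 𝔭 ≤
        lengthAt (IwasawaAlgebra p) (IwasawaAlgebra p ⧸ Ideal.span {c z₀}) 𝔭 := by
  -- `𝔭 = (π)` with `π` prime
  obtain ⟨π, hπ𝔭⟩ := (UniqueFactorizationMonoid.isPrincipal_of_height_eq_one h𝔭 :
    𝔭.asIdeal.IsPrincipal).principal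
  have hπ𝔭' : 𝔭.asIdeal = Ideal.span {π} := hπ𝔭
  have hπ0 : π ≠ 0 := by
    rintro rfl
    have hbot : 𝔭.asIdeal = ⊥ := by rw [hπ𝔭']; simp
    have := h𝔭
    rw [hbot, Ideal.height_bot] at this
    exact zero_ne_one this
  have hπ : Prime π := (Ideal.span_singleton_prime hπ0).mp (hπ𝔭' ▸ 𝔭.isPrime)
  -- `e = ord_π (c z₀)`, finite
  have hby := isTorsionBy_quotient_span_singleton (R := IwasawaAlgebra p) (c z₀)
  have hfin : lengthAt (IwasawaAlgebra p) (IwasawaAlgebra p ⧸ Ideal.span {c z₀}) 𝔭 ≠ ⊤ :=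
    lengthAt_ne_top_of_isTorsionBy hc₀ hby 𝔭 (le_of_eq h𝔭)
  obtain ⟨e, he⟩ := ENat.ne_top_iff_exists.mp hfin
  -- if every `c s`, `s ∈ S`, were divisible by `π^{e+1}`, so would be `c z₀`
  by_contra hall
  push Not at hall
  have hsub : S ⊆ Submodule.comap c (Ideal.span {π ^ (e + 1)}) := by
    intro s hs
    rw [SetLike.mem_coe, Submodule.mem_comap, Ideal.mem_span_singleton]
    by_cases hcs : c s = 0
    · rw [hcs]; exact dvd_zero _
    · have hlt := hall s hs hcs
      rw [← he] at hlt
      have hle : ((e + 1 : ℕ) : ℕ∞) ≤ lengthAt (IwasawaAlgebra p) (IwasawaAlgebra p ⧸ Ideal.span {c s}) 𝔭 := by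
        rw [Nat.cast_add, Nat.cast_one]
        exact Order.add_one_le_of_lt hlt
      exact pow_dvd_of_le_lengthAt_quotient hπ hcs 𝔭 hπ𝔭' hle
  have hz : z₀ ∈ Submodule.comap c (Ideal.span {π ^ (e + 1)}) := Submodule.span_le.mpr hsub hz₀
  rw [Submodule.mem_comap, Ideal.mem_span_singleton] at hz
  have := le_lengthAt_quotient_span_singleton_of_pow_dvd hπ hc₀ 𝔭 hπ𝔭' hz
  rw [← he, Nat.cast_le] at this
  omega

end Generator

/-! ### §2 Kato's Thm. 13.4 (2) in the ledger: an Euler-system class below the zeta index; `x^nat ≤ k` off `(p)` -/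

section Package

variable (W : WeierstrassCurve ℚ) [W.IsElliptic] (p : ℕ) [Fact p.Prime]
  [ContinuousSMul ℤ_[p] (W.tateModule p)] [Module.Free ℤ_[p] (W.tateModule p)]
  [Module.Finite ℤ_[p] (W.tateModule p)]
  {N : ℕ} {f : CuspForm (Gamma0 N) 2} {ϖ : ℚ} {κ : ZpExtension ℚ p} {γ : absoluteGaloisGroup ℚ}
  {E : Type} [Field E] [Algebra ℚ E] {ι : AlgebraicClosure ℚ →ₐ[ℚ] AlgebraicClosure E} {ap : ℤ}
  {g : absoluteGaloisGroup E} {c : ℕ → localPoints W E} {I : IwasawaH1Data W p κ γ}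

/-- **An Euler-system class below the zeta index.** For a ♯/♭ package `C` of colour `•` with `L^• ≠ 0`, `E[p]` irreducible,
Néron-normalised `G₁ ≠ 0`, and a height-one `𝔭`: some GENUINE Euler-system class `s ≠ 0` (`Kato2004.IsEulerSystemClass`)
has `ℓ_𝔭(I.H ⧸ Λs) ≤ ℓ_𝔭(I.H ⧸ C.Z)`. Route: `s₁G₁ = Col(z₀)`, `z₀ ∈ Z ⊆ span{ES classes}` (`image_zeta_localized`,
`zeta_le_span`); §1 gives `s` with `ℓ_𝔭 Λ/(Col s) ≤ ℓ_𝔭 Λ/(G₁) = k + c^•` (content identity), and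
`ℓ_𝔭 Λ/(Col s) = ℓ_𝔭(I.H ⧸ Λs) + c^•`. [cite: Kato2004Asterisque, Thm. 12.6 (p. 222), Ex. 13.3 (p. 225)]
[cite: Sprung2012, Def. 6.1 (p. 1495), Thm. 7.14 (3) (p. 1504)] -/
theorem _root_.Literature.NumberTheory.EllipticCurves.Sprung2012.SharpFlatColemanKatoData.exists_isEulerSystemClass_lengthAt_quotient_le_zeta
    {col : Chroma} (C : SharpFlatColemanKatoData W p f ϖ κ γ ι ap g c col I)
    (hirr : W.HasIrreducibleModPGaloisRep p) {Lsharp Lflat G₁ : IwasawaAlgebra p}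
    (hSP : IsSprungPair f p ap Lsharp Lflat) (hcol : chromaticL col Lsharp Lflat ≠ 0)
    (hG₁ : iwasawaToPowerSeries p G₁ =
      PowerSeries.C ((ϖ : ℚ) : ℚ_[p]) * iwasawaToPowerSeries p (chromaticL col Lsharp Lflat))
    (hG0 : G₁ ≠ 0) (𝔭 : PrimeSpectrum (IwasawaAlgebra p)) (h𝔭 : 𝔭.asIdeal.height = 1) :
    ∃ s : I.H, IsEulerSystemClass W p κ γ I s ∧ s ≠ 0 ∧
      lengthAt (IwasawaAlgebra p) (I.H ⧸ Submodule.span (IwasawaAlgebra p) {s}) 𝔭 ≤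
        lengthAt (IwasawaAlgebra p) (I.H ⧸ C.Z) 𝔭 := by
  obtain ⟨s₁, hs₁, hs₁G, -⟩ := C.image_zeta_localized hirr Lsharp Lflat G₁ hSP hG₁ 𝔭 h𝔭
  obtain ⟨z₀, hz₀Z, hz₀⟩ := Submodule.mem_map.mp hs₁G
  have hs₁0 : s₁ ≠ 0 := fun h0 => hs₁ (h0 ▸ 𝔭.asIdeal.zero_mem)
  have hc₀ : C.colMap z₀ ≠ 0 := by rw [hz₀]; exact mul_ne_zero hs₁0 hG0
  obtain ⟨s, hsS, hcs, hle⟩ :=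
    exists_mem_lengthAt_quotient_span_le_of_mem_span C.colMap (C.zeta_le_span hz₀Z) hc₀ 𝔭 h𝔭
  have hs0 : s ≠ 0 := fun h0 => hcs (by rw [h0, map_zero])
  refine ⟨s, hsS, hs0, ?_⟩
  -- `ℓ_𝔭 Λ/(Col z₀) = ℓ_𝔭 Λ/(s₁ G₁) = ℓ_𝔭 Λ/(G₁) = k + c`
  have hz₀len : lengthAt (IwasawaAlgebra p) (IwasawaAlgebra p ⧸ Ideal.span {C.colMap z₀}) 𝔭 =
      lengthAt (IwasawaAlgebra p) (I.H ⧸ C.Z) 𝔭 +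
        lengthAt (IwasawaAlgebra p) (IwasawaAlgebra p ⧸ LinearMap.range C.colMap) 𝔭 := by
    rw [hz₀, lengthAt_quotient_span_singleton_mul G₁ hs₁0 𝔭,
      lengthAt_quotient_eq_zero_of_not_le (by rwa [Ideal.span_singleton_le_iff_mem]), zero_add,
      C.lengthAt_quotient_span_eq_zeta_add_range W p hirr hSP hcol hG₁ 𝔭 h𝔭]
  -- `ℓ_𝔭 Λ/(Col s) = ℓ_𝔭(I.H ⧸ Λs) + c`
  have hslen : lengthAt (IwasawaAlgebra p) (IwasawaAlgebra p ⧸ Ideal.span {C.colMap s}) 𝔭 =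
      lengthAt (IwasawaAlgebra p) (I.H ⧸ Submodule.span (IwasawaAlgebra p) {s}) 𝔭 +
        lengthAt (IwasawaAlgebra p) (IwasawaAlgebra p ⧸ LinearMap.range C.colMap) 𝔭 := by
    rw [← lengthAt_quotient_map_eq_add C.colMap (C.colMap_injective Lsharp Lflat hSP hcol) _ 𝔭,
      Submodule.map_span, Set.image_singleton]
  -- cancel the finite local index `c`
  have hc : lengthAt (IwasawaAlgebra p) (IwasawaAlgebra p ⧸ LinearMap.range C.colMap) 𝔭 ≠ ⊤ := by
    have hm : lengthAt (IwasawaAlgebra p) (IwasawaAlgebra p ⧸ Ideal.span {C.colMap z₀}) 𝔭 ≠ ⊤ :=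
      lengthAt_ne_top_of_isTorsionBy hc₀ (isTorsionBy_quotient_span_singleton (C.colMap z₀)) 𝔭 (le_of_eq h𝔭)
    rw [hz₀len] at hm
    exact fun htop => hm (by rw [htop, add_top])
  rw [hz₀len, hslen] at hle
  exact (ENat.addLECancellable_of_ne_top hc).add_le_add_iff_right.mp hle

/-- **KATO'S THM. 13.4 (2) IN THE LEDGER, PRINT-KEYED: `ℓ_𝔭 X₀^nat ≤ ℓ_𝔭(I.H ⧸ Z)` off `(p)`.** For a ♯/♭ package `C` of colour
`•` (`L^• ≠ 0`, `E[p]` irreducible, Néron-normalised `G₁ ≠ 0`) on a pinned `I` over the cyclotomic `(κ, γ)`, `p` odd, `E`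
non-CM, and a fine dual datum `FB` of key `γ⁻¹` (the PRINT-EXACT keying against the natural `I`, module docstring of
`Kato2004/EulerSystemBoundFineSelmerContragredient.lean`): at every height-one `𝔭 ∌ p`, `ℓ_𝔭 FB.X ≤ ℓ_𝔭(I.H ⧸ C.Z)`. Proof:
an Euler-system class `s ≠ 0` below the zeta index (previous theorem) and Kato's Thm. 13.4 (2) for `s`, hypothesis (v)
from Serre's open image (`exists_finrank_quotient_range_sub_one_eq_one_of_forall_congruence`). CONDITIONAL on `h134C`,
`hSerre` (displayed). [cite: Kato2004Asterisque, Thm. 12.5 (p. 222), Thm. 13.4 (2) (p. 226)]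
[cite: SerreAbelianLadic1968, Ch. IV §2.2 (IV-11)] [cite: Sprung2012, Thm. 7.14 (3) (p. 1504)] -/
theorem _root_.Literature.NumberTheory.EllipticCurves.Sprung2012.SharpFlatColemanKatoData.fineContra_le_zeta_of_thm13_4
    (h134C : thm13_4_lengthAt_fineSelmerDualContra_le_of_isEulerSystemClass)
    (hSerre : serre_adicImage_contains_congruenceSubgroup)
    {col : Chroma} (C : SharpFlatColemanKatoData W p f ϖ κ γ ι ap g c col I)
    (hp : p ≠ 2) (hκ : κ.IsCyclotomic) (hγ : κ.IsTopGenerator γ) (hCM : ¬ W.HasCM)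
    (hirr : W.HasIrreducibleModPGaloisRep p) {Lsharp Lflat G₁ : IwasawaAlgebra p}
    (hSP : IsSprungPair f p ap Lsharp Lflat) (hcol : chromaticL col Lsharp Lflat ≠ 0)
    (hG₁ : iwasawaToPowerSeries p G₁ =
      PowerSeries.C ((ϖ : ℚ) : ℚ_[p]) * iwasawaToPowerSeries p (chromaticL col Lsharp Lflat))
    (hG0 : G₁ ≠ 0) (FB : W.FineSelmerDualData κ γ⁻¹)
    (𝔭 : PrimeSpectrum (IwasawaAlgebra p)) (h𝔭 : 𝔭.asIdeal.height = 1)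
    (hp𝔭 : (p : IwasawaAlgebra p) ∉ 𝔭.asIdeal) :
    lengthAt (IwasawaAlgebra p) FB.X 𝔭 ≤ lengthAt (IwasawaAlgebra p) (I.H ⧸ C.Z) 𝔭 := by
  obtain ⟨s, hsES, hs0, hle⟩ :=
    C.exists_isEulerSystemClass_lengthAt_quotient_le_zeta W p hirr hSP hcol hG₁ hG0 𝔭 h𝔭
  obtain ⟨n, hn⟩ := hSerre W p hCM
  have hV := exists_finrank_quotient_range_sub_one_eq_one_of_forall_congruence W p n hn
  have hp𝔭' : PowerSeries.C (p : ℤ_[p]) ∉ 𝔭.asIdeal := by rwa [map_natCast]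
  exact ((h134C W p κ γ hp hκ hγ I FB s hsES hs0 hV).1 𝔭 h𝔭 hp𝔭').trans hle

/-! ### §3 The keying, concretely: `ℓ_{ι𝔭} Y.X ≤ k(𝔭)` and index symmetry forced by the typed stub -/

/-- **The γ-keyed reading of Kato's bound.** For the skeleton's fine dual datum `Y` of key `γ` (and any `FB` of key `γ⁻¹` to
mediate `ℓ_{ι𝔭} Y.X = ℓ_𝔭 FB.X`, `Kato2004.fineSelmerDualData_lengthAt_inv_eq`): at every height-one `𝔭 ∌ p`,
`ℓ_{ι𝔭} Y.X ≤ ℓ_𝔭(I.H ⧸ C.Z)` where `ι𝔭 = PrimeSpectrum.comap (invol p) 𝔭`. So the TYPED stub (`k ≤ ℓ Y.X` at the SAME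
prime) compares `k(𝔭)` with a quantity that Kato bounds by `k(ι𝔭)`, not by `k(𝔭)` (STUB-PLAN §0bis).
CONDITIONAL on `h134C`, `hSerre`. [cite: Kato2004Asterisque, Thm. 13.4 (2) (p. 226)] [cite: Greenberg1989, §0] -/
theorem _root_.Literature.NumberTheory.EllipticCurves.Sprung2012.SharpFlatColemanKatoData.fine_comap_invol_le_zeta_of_thm13_4
    (h134C : thm13_4_lengthAt_fineSelmerDualContra_le_of_isEulerSystemClass)
    (hSerre : serre_adicImage_contains_congruenceSubgroup)
    {col : Chroma} (C : SharpFlatColemanKatoData W p f ϖ κ γ ι ap g c col I)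
    (hp : p ≠ 2) (hκ : κ.IsCyclotomic) (hγ : κ.IsTopGenerator γ) (hCM : ¬ W.HasCM)
    (hirr : W.HasIrreducibleModPGaloisRep p) {Lsharp Lflat G₁ : IwasawaAlgebra p}
    (hSP : IsSprungPair f p ap Lsharp Lflat) (hcol : chromaticL col Lsharp Lflat ≠ 0)
    (hG₁ : iwasawaToPowerSeries p G₁ =
      PowerSeries.C ((ϖ : ℚ) : ℚ_[p]) * iwasawaToPowerSeries p (chromaticL col Lsharp Lflat))
    (hG0 : G₁ ≠ 0) (Y : W.FineSelmerDualData κ γ) (FB : W.FineSelmerDualData κ γ⁻¹)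
    (𝔭 : PrimeSpectrum (IwasawaAlgebra p)) (h𝔭 : 𝔭.asIdeal.height = 1)
    (hp𝔭 : (p : IwasawaAlgebra p) ∉ 𝔭.asIdeal) :
    lengthAt (IwasawaAlgebra p) Y.X (PrimeSpectrum.comap (invol p).toRingHom 𝔭) ≤
      lengthAt (IwasawaAlgebra p) (I.H ⧸ C.Z) 𝔭 := by
  rw [← Kato2004.fineSelmerDualData_lengthAt_inv_eq Y FB 𝔭]
  exact C.fineContra_le_zeta_of_thm13_4 W p h134C hSerre hp hκ hγ hCM hirr hSP hcol hG₁ hG0 FB 𝔭 h𝔭 hp𝔭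

/-- `ι𝔭` is again a height-one prime not containing `p` (`ι` is a `ℤ_p`-algebra automorphism fixing constants). [folklore] -/
theorem comap_invol_heightOne_not_mem {p : ℕ} [Fact p.Prime] (𝔭 : PrimeSpectrum (IwasawaAlgebra p))
    (h𝔭 : 𝔭.asIdeal.height = 1) (hp𝔭 : (p : IwasawaAlgebra p) ∉ 𝔭.asIdeal) :
    (PrimeSpectrum.comap (invol p).toRingHom 𝔭).asIdeal.height = 1 ∧
      (p : IwasawaAlgebra p) ∉ (PrimeSpectrum.comap (invol p).toRingHom 𝔭).asIdeal := by
  refine ⟨(Kato2004.height_comap_invol 𝔭).trans h𝔭, ?_⟩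
  rw [PrimeSpectrum.comap_asIdeal, Ideal.mem_comap, ← map_natCast (PowerSeries.C (R := ℤ_[p])) p]
  change invol p (PowerSeries.C (p : ℤ_[p])) ∉ 𝔭.asIdeal
  rw [invol_C, map_natCast]
  exact hp𝔭

/-- **INDEX MONOTONICITY forced by the typed stub.** If the TYPED body of `stub_katoFineLowerSporadic` holds at `ι𝔭` for the
package `C` and the γ-keyed `Y` (`k(ι𝔭) ≤ ℓ_{ι𝔭} Y.X`), then `k(ι𝔭) ≤ k(𝔭)` (height-one `𝔭 ∌ p`; Kato's bound at `𝔭` read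
through the keying). CONDITIONAL on `h134C`, `hSerre`. [cite: Kato2004Asterisque, Conj. 12.10 (p. 224), Thm. 13.4 (p. 226)] -/
theorem _root_.Literature.NumberTheory.EllipticCurves.Sprung2012.SharpFlatColemanKatoData.zeta_comap_invol_le_zeta_of_katoFineLowerAt
    (h134C : thm13_4_lengthAt_fineSelmerDualContra_le_of_isEulerSystemClass)
    (hSerre : serre_adicImage_contains_congruenceSubgroup)
    {col : Chroma} (C : SharpFlatColemanKatoData W p f ϖ κ γ ι ap g c col I)
    (hp : p ≠ 2) (hκ : κ.IsCyclotomic) (hγ : κ.IsTopGenerator γ) (hCM : ¬ W.HasCM)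
    (hirr : W.HasIrreducibleModPGaloisRep p) {Lsharp Lflat G₁ : IwasawaAlgebra p}
    (hSP : IsSprungPair f p ap Lsharp Lflat) (hcol : chromaticL col Lsharp Lflat ≠ 0)
    (hG₁ : iwasawaToPowerSeries p G₁ =
      PowerSeries.C ((ϖ : ℚ) : ℚ_[p]) * iwasawaToPowerSeries p (chromaticL col Lsharp Lflat))
    (hG0 : G₁ ≠ 0) (Y : W.FineSelmerDualData κ γ) (FB : W.FineSelmerDualData κ γ⁻¹)
    (𝔭 : PrimeSpectrum (IwasawaAlgebra p)) (h𝔭 : 𝔭.asIdeal.height = 1)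
    (hp𝔭 : (p : IwasawaAlgebra p) ∉ 𝔭.asIdeal)
    (hstub : lengthAt (IwasawaAlgebra p) (I.H ⧸ C.Z) (PrimeSpectrum.comap (invol p).toRingHom 𝔭) ≤
      lengthAt (IwasawaAlgebra p) Y.X (PrimeSpectrum.comap (invol p).toRingHom 𝔭)) :
    lengthAt (IwasawaAlgebra p) (I.H ⧸ C.Z) (PrimeSpectrum.comap (invol p).toRingHom 𝔭) ≤
      lengthAt (IwasawaAlgebra p) (I.H ⧸ C.Z) 𝔭 :=
  hstub.trans (C.fine_comap_invol_le_zeta_of_thm13_4 W p h134C hSerre hp hκ hγ hCM hirr hSP hcol hG₁ hG0 Y FB 𝔭 h𝔭 hp𝔭)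

/-- **INDEX SYMMETRY forced by the typed stub on an ι-orbit** (STUB-PLAN §0bis / card k2 §0, with real objects): if the TYPED
body holds at BOTH `𝔭` and `ι𝔭` (height-one, `p ∉ 𝔭`), then `k(𝔭) = k(ι𝔭)`. So «typed K_spor on a sporadic ι-pair» ⟹ Kato's
zeta index is ι-symmetric there — the extra content of the typed stub over print Kato ⊆, isolated.
CONDITIONAL on `h134C`, `hSerre`. [cite: Kato2004Asterisque, Conj. 12.10 (p. 224), Thm. 13.4 (p. 226)] [cite: Greenberg1989, §0] -/
theorem _root_.Literature.NumberTheory.EllipticCurves.Sprung2012.SharpFlatColemanKatoData.zeta_comap_invol_eq_zeta_of_katoFineLowerAt_pair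
    (h134C : thm13_4_lengthAt_fineSelmerDualContra_le_of_isEulerSystemClass)
    (hSerre : serre_adicImage_contains_congruenceSubgroup)
    {col : Chroma} (C : SharpFlatColemanKatoData W p f ϖ κ γ ι ap g c col I)
    (hp : p ≠ 2) (hκ : κ.IsCyclotomic) (hγ : κ.IsTopGenerator γ) (hCM : ¬ W.HasCM)
    (hirr : W.HasIrreducibleModPGaloisRep p) {Lsharp Lflat G₁ : IwasawaAlgebra p}
    (hSP : IsSprungPair f p ap Lsharp Lflat) (hcol : chromaticL col Lsharp Lflat ≠ 0)
    (hG₁ : iwasawaToPowerSeries p G₁ =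
      PowerSeries.C ((ϖ : ℚ) : ℚ_[p]) * iwasawaToPowerSeries p (chromaticL col Lsharp Lflat))
    (hG0 : G₁ ≠ 0) (Y : W.FineSelmerDualData κ γ) (FB : W.FineSelmerDualData κ γ⁻¹)
    (𝔭 : PrimeSpectrum (IwasawaAlgebra p)) (h𝔭 : 𝔭.asIdeal.height = 1)
    (hp𝔭 : (p : IwasawaAlgebra p) ∉ 𝔭.asIdeal)
    (hstub : lengthAt (IwasawaAlgebra p) (I.H ⧸ C.Z) 𝔭 ≤ lengthAt (IwasawaAlgebra p) Y.X 𝔭)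
    (hstub' : lengthAt (IwasawaAlgebra p) (I.H ⧸ C.Z) (PrimeSpectrum.comap (invol p).toRingHom 𝔭) ≤
      lengthAt (IwasawaAlgebra p) Y.X (PrimeSpectrum.comap (invol p).toRingHom 𝔭)) :
    lengthAt (IwasawaAlgebra p) (I.H ⧸ C.Z) 𝔭 =
      lengthAt (IwasawaAlgebra p) (I.H ⧸ C.Z) (PrimeSpectrum.comap (invol p).toRingHom 𝔭) := by
  refine le_antisymm ?_
    (C.zeta_comap_invol_le_zeta_of_katoFineLowerAt W p h134C hSerre hp hκ hγ hCM hirr hSP hcol hG₁ hG0 Y FB 𝔭 h𝔭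
      hp𝔭 hstub')
  -- apply the monotonicity at `ι𝔭`, using `ιι𝔭 = 𝔭`
  obtain ⟨h𝔭', hp𝔭'⟩ := comap_invol_heightOne_not_mem 𝔭 h𝔭 hp𝔭
  have h := C.zeta_comap_invol_le_zeta_of_katoFineLowerAt W p h134C hSerre hp hκ hγ hCM hirr hSP hcol hG₁ hG0 Y FB
    (PrimeSpectrum.comap (invol p).toRingHom 𝔭) h𝔭' hp𝔭'
  rw [Kato2004.comap_invol_comap_invol] at h
  exact h hstub

end Package

end Summit.BirchSwinnertonDyer.BirchSwinnertonDyer.Theorems.ChromaticCommonZeros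

end
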